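import Literature.Analysis.FluidPDE.AlexakisDoeringEnstrophyHolds
import Literature.Analysis.FluidPDE.NSUniqueness2DProofs
import HarnessLib

/-!
# Discharge of `AlexakisDoering2006_enstrophyDissipation_le` (Alexakis–Doering's `χ ≤ k_f² U F`)

Trunk: FluidKinetic (`Literature/Analysis/FluidPDE`). The named fact
`Literature.Analysis.FluidPDE.AlexakisDoering2006_enstrophyDissipation_le` (`AlexakisDoering`;
Alexakis–Doering, Phys. Lett. A 359 (2006), §2, display "(VBI)" / arXiv:physics/0605090 eq. (16):
`χ ≤ k_f² U F` for every global Leray–Hopf solution of the 2-D Navier–Stokes equations on the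
unit torus driven by `F Φ(n • x)`, smooth datum, `U > 0`) is now a theorem:
`AlexakisDoeringEnstrophyHolds` proved it relative to the uniqueness of two-dimensional
Leray–Hopf solutions (`AlexakisDoering2006_enstrophyDissipation_le_of_lionsProdi`), and the
uniqueness fact `lions_prodi_uniqueness_torus2` (Lions–Prodi 1959; Foias–Manley–Rosa–Temam 2001,
Ch. II Thm. 7.3) has been discharged (`lions_prodi_uniqueness_torus2_holds`,
`NSUniqueness2DProofs`). The whole chain — Galerkin enstrophy identity (`NSGalerkinEnstrophy2D`),
steady Galerkin scheme and its Leray–Hopf limit with the enstrophy inequality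
(`NSGalerkinSteadyScheme`, `NSEnstrophyLimit2D`), transfer along a.e.-equality
(`AlexakisDoeringEnstrophyHolds`), and the averaged enstrophy balance with Cauchy–Schwarz in space
and time (`AlexakisDoeringProofs`) — is proved in the tree; axioms `propext`, `Classical.choice`,
`Quot.sound` only.

## References

* A. Alexakis, C. R. Doering, Phys. Lett. A 359 (2006), §2, display (VBI) / arXiv v1 eq. (16).
  [AlexakisDoering2006PLA]
* C. Foias, O. Manley, R. Rosa, R. Temam, *Navier–Stokes Equations and Turbulence*, CUP 2001,
  Ch. II Thm. 7.3–7.4, App. II.A (A.65). [FoiasManleyRosaTemam2001]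
-/

noncomputable section

namespace Literature.Analysis.FluidPDE

/-- **Alexakis–Doering's enstrophy-dissipation bound `χ ≤ k_f² U F`, discharged**
(Alexakis–Doering 2006, §2, display "(VBI)" / arXiv eq. (16)): the named fact
`AlexakisDoering2006_enstrophyDissipation_le` holds — `AlexakisDoering2006_enstrophyDissipation_le_of_lionsProdi`
fed with the discharged 2-D uniqueness theorem `lions_prodi_uniqueness_torus2_holds`. [cite: AlexakisDoering2006PLA, §2 display (VBI)] -/
theorem AlexakisDoering2006_enstrophyDissipation_le_holds :
    AlexakisDoering2006_enstrophyDissipation_le :=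
  AlexakisDoering2006_enstrophyDissipation_le_of_lionsProdi lions_prodi_uniqueness_torus2_holds

end Literature.Analysis.FluidPDE

end
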